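import Mathlib
import Literature.RepresentationTheory.Semisimple.CharpolySubquotient
import Literature.RepresentationTheory.Semisimple.Semisimplification
import Literature.RepresentationTheory.Semisimple.Multiplicity
import Literature.LinearAlgebra.Matrix.RankMinors
import Literature.LinearAlgebra.Matrix.GaloisStableSimilarity
import HarnessLib

/-!
# Route `PhantomRMYoshida`, crux `StableYoshidaCongruence` (stmt-Langlands-13640), line
# `burkhardt-weddle-two-three-anchor`: support for Stub 5 `stub_ordinaryFrameFp`, I (orientation)

Pure algebra used by `stub_ordinaryFrameFp` (file `…OrdinaryFrameFp.lean`), all proved: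

* invariants of representations over a field: `dim` is monotone along injective `G`-maps, invariant
  under equivalence, additive on `ρ ⊕ σ`, and LEFT EXACT along `0 → S → V → V/S → 0` in the form
  `dim V^G ≤ dim S^G + dim (V/S)^G` (`finrank_invariants_le_sub_add_quotient`);
* **semisimplification does not shrink invariants** (`exists_semisimplification_invariants`): every
  finite-dimensional representation `ρ` of a group `G` has a semisimple `ρ'` with the same
  characteristic polynomials (Bourbaki, *Algèbre* VIII § 20 n° 6, "semi-simplifié"; the tree's
  `LinearMap.charpoly_eq_charpoly_restrict_mul_charpoly_mapQ`) and, for any `φ : H → G`,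
  `dim (ρ ∘ φ)^H ≤ dim (ρ' ∘ φ)^H` — the orientation argument of the stub compares the inertia
  invariants of the residual lattice `M` with those of `M^{ss} ≅ σ ⊕ σ'` (Brauer–Nesbitt);
* block-diagonal matrices `A ⊕ B` reindexed along `e : l ⊕ m ≃ n` (products, differences, scalars,
  kernels: `ker_blockDiag_le`, `finrank_ker_blockDiag`), conjugation (`ker_conj_le`, `finrank_ker_conj`)
  and change of coefficient field (`rank_map_ringHom` by minors, `finrank_ker_map_ringHom`,
  `ker_le_ker_of_map`) — the descent of the ordinary frame from `k` to `𝔽_p`.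

No definitions; no named fact is used.  Worker of lead prover-line-stmt-Langlands-13640-c1-0
(2026-08-16).
-/

-- `Summit.Langlands.Langlands.…` (summit = sub-problem name, D-0017 layout) trips `dupNamespace`.
set_option linter.dupNamespace false

noncomputable section

open Module Matrix
open Literature.RepresentationTheory.Semisimple

namespace Summit.Langlands.Langlands.Cruxes.StableYoshidaCongruence.BurkhardtWeddleTwoThreeAnchor

universe u v w w'

/-! ## Invariants of representations: functoriality and left exactness -/

section Invariants

variable {k : Type u} [Field k] {G : Type v} [Group G]
  {V : Type w} [AddCommGroup V] [Module k V] {W : Type w'} [AddCommGroup W] [Module k W]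

/-- An injective `G`-map does not decrease the dimension of the invariants. [folklore] -/
theorem finrank_invariants_le_of_injective [FiniteDimensional k W] (ρ : Representation k G V)
    (σ : Representation k G W) (f : V →ₗ[k] W) (hf : ∀ g v, f (ρ g v) = σ g (f v))
    (hinj : Function.Injective f) :
    finrank k ρ.invariants ≤ finrank k σ.invariants := by
  let f' : ρ.invariants →ₗ[k] σ.invariants :=
    (f.comp ρ.invariants.subtype).codRestrict σ.invariants fun v =>
      (σ.mem_invariants _).2 fun g => by
        change σ g (f v) = f v
        rw [← hf, (ρ.mem_invariants _).1 v.2 g]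
  refine LinearMap.finrank_le_finrank_of_injective (f := f') fun x y hxy => ?_
  exact Subtype.ext (hinj (congrArg Subtype.val hxy))

/-- Equivalent representations have invariants of the same dimension. [folklore] -/
theorem finrank_invariants_eq_of_equiv [FiniteDimensional k V] [FiniteDimensional k W]
    {ρ : Representation k G V} {σ : Representation k G W} (e : ρ.Equiv σ) :
    finrank k ρ.invariants = finrank k σ.invariants :=
  le_antisymm
    (finrank_invariants_le_of_injective ρ σ e.toLinearEquiv.toLinearMap
      (fun g v => congr($(e.isIntertwining' g) v)) e.toLinearEquiv.injective)
    (finrank_invariants_le_of_injective σ ρ e.symm.toLinearEquiv.toLinearMap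
      (fun g v => congr($(e.symm.isIntertwining' g) v)) e.symm.toLinearEquiv.injective)

/-- `(V ⊕ W)^G = V^G ⊕ W^G`, in dimensions. [folklore] -/
theorem finrank_invariants_prod [FiniteDimensional k V] [FiniteDimensional k W]
    (ρ : Representation k G V) (σ : Representation k G W) :
    finrank k (ρ.prod σ).invariants = finrank k ρ.invariants + finrank k σ.invariants := by
  let e : (ρ.prod σ).invariants ≃ₗ[k] ρ.invariants × σ.invariants :=
    { toFun := fun x => (⟨x.1.1, fun g => congrArg Prod.fst (x.2 g)⟩,
        ⟨x.1.2, fun g => congrArg Prod.snd (x.2 g)⟩)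
      invFun := fun y => ⟨(y.1.1, y.2.1), fun g => Prod.ext (y.1.2 g) (y.2.2 g)⟩
      map_add' := fun _ _ => rfl
      map_smul' := fun _ _ => rfl
      left_inv := fun _ => rfl
      right_inv := fun _ => rfl }
  rw [e.finrank_eq, Module.finrank_prod]

/-- **Left exactness of invariants**, in dimensions: for a stable subspace `S`,
`dim V^G ≤ dim S^G + dim (V/S)^G`. [folklore] -/
theorem finrank_invariants_le_sub_add_quotient [FiniteDimensional k V] (ρ : Representation k G V)
    (S : Submodule k V) (hS : ∀ g, S ≤ S.comap (ρ g)) :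
    finrank k ρ.invariants ≤
      finrank k (ρ.subrepresentation S hS).invariants +
        finrank k (ρ.quotient S hS).invariants := by
  let π : ρ.invariants →ₗ[k] V ⧸ S := S.mkQ.comp ρ.invariants.subtype
  have h1 : finrank k (LinearMap.range π) + finrank k (LinearMap.ker π) =
      finrank k ρ.invariants := LinearMap.finrank_range_add_finrank_ker π
  have h2 : finrank k (LinearMap.range π) ≤ finrank k (ρ.quotient S hS).invariants := by
    refine Submodule.finrank_mono ?_
    rintro _ ⟨v, rfl⟩
    refine (Representation.mem_invariants _ _).2 fun g => ?_
    change Submodule.mapQ S S (ρ g) (hS g) (Submodule.Quotient.mk (v : V)) =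
      Submodule.Quotient.mk (v : V)
    rw [Submodule.mapQ_apply, (ρ.mem_invariants _).1 v.2 g]
  have h3 : finrank k (LinearMap.ker π) ≤ finrank k (ρ.subrepresentation S hS).invariants := by
    have hmem : ∀ x : LinearMap.ker π, ((x : ρ.invariants) : V) ∈ S := fun x => by
      have hx := x.2
      rw [LinearMap.mem_ker] at hx
      exact (Submodule.Quotient.mk_eq_zero S).1 hx
    let j : LinearMap.ker π →ₗ[k] (ρ.subrepresentation S hS).invariants :=
      { toFun := fun x => ⟨⟨((x : ρ.invariants) : V), hmem x⟩, fun g => Subtype.ext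
          ((ρ.mem_invariants _).1 (x : ρ.invariants).2 g)⟩
        map_add' := fun _ _ => rfl
        map_smul' := fun _ _ => rfl }
    refine LinearMap.finrank_le_finrank_of_injective (f := j) fun x y hxy => ?_
    have := congrArg (fun z : (ρ.subrepresentation S hS).invariants => ((z : S) : V)) hxy
    exact Subtype.ext (Subtype.ext this)
  omega

end Invariants

/-! ## Semisimplification with invariants -/

section Semisimplification

variable {k : Type u} [Field k] {G : Type v} [Group G] {H : Type*} [Group H] (φ : H →* G)

/-- Induction carrier for `exists_semisimplification_invariants`. [folklore] -/
theorem exists_semisimplification_invariants_aux (n : ℕ) :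
    ∀ (V : Type w) [AddCommGroup V] [Module k V] [FiniteDimensional k V]
      (ρ : Representation k G V), finrank k V < n →
      ∃ (V' : Type w) (_ : AddCommGroup V') (_ : Module k V') (_ : FiniteDimensional k V')
        (ρ' : Representation k G V'),
        ρ'.IsSemisimpleRepresentation ∧ (∀ g, (ρ' g).charpoly = (ρ g).charpoly) ∧
        finrank k (Representation.invariants (ρ.comp φ)) ≤
          finrank k (Representation.invariants (ρ'.comp φ)) := by
  induction n with
  | zero => intro V _ _ _ ρ h; exact absurd h (Nat.not_lt_zero _)
  | succ n ih =>
    intro V _ _ _ ρ hV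
    by_cases hss : ρ.IsSemisimpleRepresentation
    · exact ⟨V, inferInstance, inferInstance, inferInstance, ρ, hss, fun _ => rfl, le_rfl⟩
    obtain ⟨S, hS0, hS1⟩ := exists_ne_bot_ne_top_of_not_isSemisimpleRepresentation ρ hss
    have hle : ∀ g, S.toSubmodule ≤ S.toSubmodule.comap (ρ g) := fun g v hv =>
      S.apply_mem_toSubmodule g hv
    have hbot : S.toSubmodule ≠ ⊥ := fun h =>
      hS0 (Subrepresentation.toSubmodule_injective (h.trans rfl))
    have htop : S.toSubmodule ≠ ⊤ := fun h =>
      hS1 (Subrepresentation.toSubmodule_injective (h.trans rfl))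
    have hsum := S.toSubmodule.finrank_quotient_add_finrank
    have hposS : 0 < finrank k S.toSubmodule := by
      rw [Nat.pos_iff_ne_zero, Ne, Submodule.finrank_eq_zero]; exact hbot
    have hltS : finrank k S.toSubmodule < finrank k V := Submodule.finrank_lt htop
    have hdimS : finrank k S.toSubmodule < n := by omega
    have hdimQ : finrank k (V ⧸ S.toSubmodule) < n := by omega
    obtain ⟨V₁, _, _, _, ρ₁, hss₁, hcp₁, hinv₁⟩ :=
      ih S.toSubmodule (ρ.subrepresentation S.toSubmodule hle) hdimS
    obtain ⟨V₂, _, _, _, ρ₂, hss₂, hcp₂, hinv₂⟩ :=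
      ih (V ⧸ S.toSubmodule) (ρ.quotient S.toSubmodule hle) hdimQ
    haveI := hss₁; haveI := hss₂
    refine ⟨V₁ × V₂, inferInstance, inferInstance, inferInstance, ρ₁.prod ρ₂, inferInstance,
      fun g => ?_, ?_⟩
    · change ((ρ₁ g).prodMap (ρ₂ g)).charpoly = _
      rw [LinearMap.charpoly_prodMap, hcp₁, hcp₂]
      exact (LinearMap.charpoly_eq_charpoly_restrict_mul_charpoly_mapQ (ρ g) S.toSubmodule
        (hle g)).symm
    · calc finrank k (Representation.invariants (ρ.comp φ))
          ≤ finrank k (Representation.subrepresentation (ρ.comp φ) S.toSubmodule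
                fun h => hle (φ h)).invariants +
              finrank k (Representation.quotient (ρ.comp φ) S.toSubmodule
                fun h => hle (φ h)).invariants :=
            finrank_invariants_le_sub_add_quotient _ _ _
        _ ≤ finrank k (Representation.invariants (ρ₁.comp φ)) +
              finrank k (Representation.invariants (ρ₂.comp φ)) := add_le_add hinv₁ hinv₂
        _ = finrank k (Representation.invariants ((ρ₁.prod ρ₂).comp φ)) :=
            (finrank_invariants_prod _ _).symm

end Semisimplification

/-- **Semisimplification does not shrink invariants.**  Every finite-dimensional representation `ρ`
of `G` over a field has a semisimple representation `ρ'` (its semisimplification) with the same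
characteristic polynomials and, for any `φ : H → G`, `dim (ρ|_H)^H ≤ dim (ρ'|_H)^H` (invariants
are left exact along `0 → S → V → V/S → 0`).  Registered sub-goal of the crux item (support for
`stub_ordinaryFrameFp`). [cite: BourbakiAlgebreVIII2012, VIII § 20 n° 6 (p. 377)] -/
theorem exists_semisimplification_invariants :
    ∀ {k : Type} [Field k] {G : Type} [Group G] {H : Type} [Group H] (φ : H →* G)
      (V : Type) [AddCommGroup V] [Module k V] [FiniteDimensional k V] (ρ : Representation k G V),
      ∃ (V' : Type) (_ : AddCommGroup V') (_ : Module k V') (_ : FiniteDimensional k V')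
        (ρ' : Representation k G V'),
        ρ'.IsSemisimpleRepresentation ∧ (∀ g, (ρ' g).charpoly = (ρ g).charpoly) ∧
        Module.finrank k (Representation.invariants (ρ.comp φ)) ≤
          Module.finrank k (Representation.invariants (ρ'.comp φ)) :=
  fun φ V _ _ _ ρ =>
    exists_semisimplification_invariants_aux φ (Module.finrank _ V + 1) V ρ (Nat.lt_succ_self _)


/-! ## Block-diagonal matrices `A ⊕ B`, reindexed along `e : l ⊕ m ≃ n` -/

section BlockDiag

variable {l m n : Type*} {R : Type*} [CommRing R] (e : l ⊕ m ≃ n)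

/-- `(A ⊕ B)(A' ⊕ B') = AA' ⊕ BB'`. [folklore] -/
theorem blockDiag_mul [Fintype l] [Fintype m] [Fintype n] (A A' : Matrix l l R)
    (B B' : Matrix m m R) :
    reindex e e (fromBlocks A 0 0 B) * reindex e e (fromBlocks A' 0 0 B') =
      reindex e e (fromBlocks (A * A') 0 0 (B * B')) := by
  simp only [reindex_apply, submatrix_mul_equiv, fromBlocks_multiply, Matrix.mul_zero,
    Matrix.zero_mul, add_zero, zero_add]

/-- `(A ⊕ B) - (A' ⊕ B') = (A - A') ⊕ (B - B')`. [folklore] -/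
theorem blockDiag_sub (A A' : Matrix l l R) (B B' : Matrix m m R) :
    reindex e e (fromBlocks A 0 0 B) - reindex e e (fromBlocks A' 0 0 B') =
      reindex e e (fromBlocks (A - A') 0 0 (B - B')) := by
  have h : reindex e e (fromBlocks A 0 0 B) - reindex e e (fromBlocks A' 0 0 B') =
      reindex e e (fromBlocks A 0 0 B - fromBlocks A' 0 0 B') :=
    ((Matrix.reindexLinearEquiv R R e e).map_sub (fromBlocks A 0 0 B) (fromBlocks A' 0 0 B')).symm
  rw [h]
  congr 1
  ext (i | i) (j | j) <;> simp

/-- `1 ⊕ 1 = 1`. [folklore] -/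
theorem blockDiag_one [DecidableEq l] [DecidableEq m] [DecidableEq n] :
    reindex e e (fromBlocks (1 : Matrix l l R) 0 0 (1 : Matrix m m R)) = 1 := by
  rw [fromBlocks_one, reindex_apply, submatrix_one_equiv]

/-- `a ⊕ a = a` for a scalar `a`. [folklore] -/
theorem blockDiag_smul_one [DecidableEq l] [DecidableEq m] [DecidableEq n] (a : R) :
    reindex e e (fromBlocks (a • (1 : Matrix l l R)) 0 0 (a • (1 : Matrix m m R))) =
      a • (1 : Matrix n n R) := by
  have h1 : fromBlocks (a • (1 : Matrix l l R)) 0 0 (a • (1 : Matrix m m R)) =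
      a • fromBlocks 1 0 0 1 := by
    rw [fromBlocks_smul, smul_zero, smul_zero]
  have h2 : reindex e e (a • fromBlocks (1 : Matrix l l R) 0 0 (1 : Matrix m m R)) =
      a • reindex e e (fromBlocks 1 0 0 1) :=
    (Matrix.reindexLinearEquiv R R e e).map_smul a _
  rw [h1, h2, blockDiag_one]

/-- `0 ⊕ 0 = 0`. [folklore] -/
theorem blockDiag_zero :
    reindex e e (fromBlocks (0 : Matrix l l R) 0 0 (0 : Matrix m m R)) = 0 := by
  rw [fromBlocks_zero, reindex_apply, submatrix_zero, Pi.zero_apply, Pi.zero_apply]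

/-- `(A ⊕ B) v = 0` iff `A` kills the `l`-part of `v` and `B` its `m`-part. [folklore] -/
theorem blockDiag_mulVec_eq_zero_iff [Fintype l] [Fintype m] [Fintype n] (A : Matrix l l R)
    (B : Matrix m m R) (v : n → R) :
    reindex e e (fromBlocks A 0 0 B) *ᵥ v = 0 ↔
      A *ᵥ (fun i => v (e (Sum.inl i))) = 0 ∧ B *ᵥ (fun j => v (e (Sum.inr j))) = 0 := by
  rw [reindex_apply, submatrix_mulVec_equiv]
  have hv : v ∘ e.symm.symm =
      Sum.elim (fun i => v (e (Sum.inl i))) (fun j => v (e (Sum.inr j))) := by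
    ext (i | j) <;> simp
  rw [hv, fromBlocks_mulVec]
  simp only [zero_mulVec, add_zero, zero_add]
  constructor
  · intro h
    refine ⟨funext fun i => ?_, funext fun j => ?_⟩
    · simpa using congrFun h (e (Sum.inl i))
    · simpa using congrFun h (e (Sum.inr j))
  · rintro ⟨h1, h2⟩
    funext x
    obtain ⟨y, rfl⟩ := e.surjective x
    rcases y with i | j
    · simp [h1]
    · simp [h2]

variable {F : Type*} [Field F] [Fintype l] [Fintype m] [Fintype n]

/-- Kernel inclusions pass to block-diagonal sums. [folklore] -/
theorem ker_blockDiag_le {A Q : Matrix l l F} {B P : Matrix m m F}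
    (h₁ : LinearMap.ker A.mulVecLin ≤ LinearMap.ker Q.mulVecLin)
    (h₂ : LinearMap.ker B.mulVecLin ≤ LinearMap.ker P.mulVecLin) :
    LinearMap.ker (reindex e e (fromBlocks A 0 0 B)).mulVecLin ≤
      LinearMap.ker (reindex e e (fromBlocks Q 0 0 P)).mulVecLin := by
  intro v hv
  rw [LinearMap.mem_ker, mulVecLin_apply, blockDiag_mulVec_eq_zero_iff] at hv ⊢
  exact ⟨h₁ (show _ ∈ LinearMap.ker A.mulVecLin from hv.1),
    h₂ (show _ ∈ LinearMap.ker B.mulVecLin from hv.2)⟩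

/-- `dim ker (A ⊕ B) = dim ker A + dim ker B`. [folklore] -/
theorem finrank_ker_blockDiag (A : Matrix l l F) (B : Matrix m m F) :
    finrank F (LinearMap.ker (reindex e e (fromBlocks A 0 0 B)).mulVecLin) =
      finrank F (LinearMap.ker A.mulVecLin) + finrank F (LinearMap.ker B.mulVecLin) := by
  have hmem : ∀ v : n → F, v ∈ LinearMap.ker (reindex e e (fromBlocks A 0 0 B)).mulVecLin ↔
      (fun i => v (e (Sum.inl i))) ∈ LinearMap.ker A.mulVecLin ∧
        (fun j => v (e (Sum.inr j))) ∈ LinearMap.ker B.mulVecLin := fun v => by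
    simp only [LinearMap.mem_ker, mulVecLin_apply]
    exact blockDiag_mulVec_eq_zero_iff e A B v
  let L : LinearMap.ker (reindex e e (fromBlocks A 0 0 B)).mulVecLin ≃ₗ[F]
      (LinearMap.ker A.mulVecLin × LinearMap.ker B.mulVecLin) :=
    { toFun := fun v => (⟨fun i => v.1 (e (Sum.inl i)), ((hmem v.1).1 v.2).1⟩,
        ⟨fun j => v.1 (e (Sum.inr j)), ((hmem v.1).1 v.2).2⟩)
      invFun := fun w => ⟨fun x => Sum.elim w.1.1 w.2.1 (e.symm x), (hmem _).2 (by
        constructor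
        · convert w.1.2 using 1; funext i; simp
        · convert w.2.2 using 1; funext j; simp)⟩
      left_inv := fun v => by
        apply Subtype.ext
        funext x
        obtain ⟨y, rfl⟩ := e.surjective x
        rcases y with i | j <;> simp
      right_inv := fun w => by
        ext <;> simp
      map_add' := fun _ _ => rfl
      map_smul' := fun _ _ => rfl }
  rw [L.finrank_eq, Module.finrank_prod]

end BlockDiag

/-! ## Conjugation, change of coefficients, frames -/

section Conj

variable {F E : Type*} [Field F] [Field E] {n : Type*} [Fintype n] [DecidableEq n]

/-- Kernel inclusions are conjugation invariant. [folklore] -/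
theorem ker_conj_le {M Q : Matrix n n F} (P : GL n F)
    (h : LinearMap.ker M.mulVecLin ≤ LinearMap.ker Q.mulVecLin) :
    LinearMap.ker (P.val * M * (P⁻¹).val).mulVecLin ≤
      LinearMap.ker (P.val * Q * (P⁻¹).val).mulVecLin := by
  intro v hv
  rw [LinearMap.mem_ker, mulVecLin_apply, ← mulVec_mulVec, ← mulVec_mulVec] at hv ⊢
  have hv' : M *ᵥ ((P⁻¹).val *ᵥ v) = 0 := by
    have h1 := congrArg (fun w => (P⁻¹).val *ᵥ w) hv
    rwa [mulVec_mulVec, Units.inv_mul, one_mulVec, mulVec_zero] at h1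
  have h2 : Q *ᵥ ((P⁻¹).val *ᵥ v) = 0 := h (show _ ∈ LinearMap.ker M.mulVecLin from hv')
  rw [h2, mulVec_zero]

/-- The nullity is conjugation invariant. [folklore] -/
theorem finrank_ker_conj (M : Matrix n n F) (P : GL n F) :
    finrank F (LinearMap.ker (P.val * M * (P⁻¹).val).mulVecLin) =
      finrank F (LinearMap.ker M.mulVecLin) := by
  have h := Literature.LinearAlgebra.Matrix.finrank_ker_mulVecLin_conj M P⁻¹
  rwa [inv_inv] at h

omit [DecidableEq n] in
/-- The rank of a matrix is unchanged by an (injective) change of coefficient field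
(rank = size of the largest non-vanishing minor). [folklore] -/
theorem rank_map_ringHom {m : Type*} [Fintype m] (A : Matrix m n F) (f : F →+* E) :
    (A.map f).rank = A.rank := by
  have key : ∀ s : ℕ, (A.map f).rank ≤ s ↔ A.rank ≤ s := fun s => by
    rw [Literature.LinearAlgebra.Matrix.rank_le_iff_det_submatrix_eq_zero,
      Literature.LinearAlgebra.Matrix.rank_le_iff_det_submatrix_eq_zero]
    refine forall_congr' fun r => forall_congr' fun c => ?_
    rw [Matrix.submatrix_map, ← RingHom.mapMatrix_apply, ← RingHom.map_det,
      map_eq_zero_iff f f.injective]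
  exact le_antisymm ((key _).2 le_rfl) ((key _).1 le_rfl)

omit [DecidableEq n] in
/-- The nullity of a square matrix is unchanged by a change of coefficient field. [folklore] -/
theorem finrank_ker_map_ringHom (A : Matrix n n F) (f : F →+* E) :
    finrank E (LinearMap.ker (A.map f).mulVecLin) = finrank F (LinearMap.ker A.mulVecLin) := by
  have h1 := Literature.LinearAlgebra.Matrix.finrank_ker_mulVecLin_add_rank (A.map f)
  have h2 := Literature.LinearAlgebra.Matrix.finrank_ker_mulVecLin_add_rank A
  rw [rank_map_ringHom] at h1
  omega

omit [DecidableEq n] in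
/-- `A^f (f ∘ v) = f ∘ (A v)`. [folklore] -/
theorem map_mulVec_comp {m : Type*} (A : Matrix m n F) (f : F →+* E) (v : n → F) :
    A.map f *ᵥ (f ∘ v) = f ∘ (A *ᵥ v) :=
  funext fun i => (RingHom.map_mulVec f A v i).symm

omit [DecidableEq n] in
/-- Kernel inclusions descend along a change of coefficient field. [folklore] -/
theorem ker_le_ker_of_map (P Q : Matrix n n F) (f : F →+* E)
    (h : LinearMap.ker (P.map f).mulVecLin ≤ LinearMap.ker (Q.map f).mulVecLin) :
    LinearMap.ker P.mulVecLin ≤ LinearMap.ker Q.mulVecLin := by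
  intro x hx
  rw [LinearMap.mem_ker, mulVecLin_apply] at hx ⊢
  have hx' : (P.map f) *ᵥ (f ∘ x) = 0 := by
    rw [map_mulVec_comp, hx]; funext i; exact map_zero f
  have h2 : (Q.map f) *ᵥ (f ∘ x) = 0 :=
    h (show _ ∈ LinearMap.ker (P.map f).mulVecLin from hx')
  rw [map_mulVec_comp] at h2
  funext i
  exact (map_eq_zero_iff f f.injective).1 (congrFun h2 i)

end Conj

end Summit.Langlands.Langlands.Cruxes.StableYoshidaCongruence.BurkhardtWeddleTwoThreeAnchor

end
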